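import Summits.AnomalousDissipation.AnomalousDissipation.Theorems.TwodBoundedEnergyZeroMomentum.Negative.SteadyShellIdentity

/-!
# Steady witnesses: a condensate costs palinstrophy above the forcing shell; dissipation is `O(ν^{1/2})`
(negative-side toolbox for the crux `TwoAndHalfD.TwodBoundedEnergyZeroMomentum`, cdisprove seat
`refuter-cdisprove-stmt-AnomalousDissipation-10786-g2-0`, gen 2)

Quantitative corollary of the straddle identity `∑_k λ_k(λ_k - Λ)‖v̂(k)‖² = 0`
(`steady_hasSum_straddle`, Constantin–Tarfulea–Vicol 2013 §2) for a smooth steady state `v` of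
`NS_ν(g)` on `𝕋²` under a Stokes eigenforce `Δg = -Λg` with `Λ ≥ λ₁ = 4π²`:

* `steady_firstShell_energy_le_supershell_palinstrophy` —
  `4π²(Λ - 4π²) ∑_{|k|²=1} ‖v̂(k)‖² ≤ ∑_{λ_k > Λ} λ_k² ‖v̂(k)‖²`:
  the PALINSTROPHY carried strictly above the forcing shell dominates `λ₁(Λ - λ₁) ×` the energy of
  the first-shell component (the condensate).  For the bounded-condensate scenario of the crux ideas
  (Gallet–Young: `O(1)` condensate `U`, forcing at `k_f`), a steady witness must hold palinstrophy
  `≳ k_f²U²` at wavenumbers beyond `k_f` — a swept linear response of size `‖w‖₂ ~ 1/(k_fU)`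
  confined to `|k| ≈ k_f ± O(1)` carries only `O(k_f/U²)` of EXCESS `λ(λ - Λ)`, whence the design
  tension `U⁴ ≲ O(1)/k_f` recorded in the crux's `Disproof.lean` §G.

* `gradNormSq_sq_le_of_isSmooth` — `(‖∇v‖₂²)² ≤ ‖v‖₂² ∫‖Δv‖²` (Green + Cauchy–Schwarz);
  `steady_work_sq_le` — for every smooth steady state of `NS_ν(g)` on `𝕋²`, `ν ≥ 0`:
  `(∫⟪g,v⟫)² ≤ ν ‖v‖₂³ ‖Δg‖₂`, i.e. injection = dissipation `ν‖∇v‖₂² ≤ ν^{1/2}‖v‖₂^{3/2}‖Δg‖₂^{1/2}`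
  (the steady Alexakis–Doering bound; Constantin–Tarfulea–Vicol 2013 §2): along a bounded steady
  branch the work of the force VANISHES like `ν^{1/2}` — every Euler endpoint `V` does no work,
  `(g, V) = 0`, and there is no anomalous dissipation on bounded steady branches;
  `steady_sobolev_bounds_of_stokesEigenforce` — under a Stokes eigenforce (`Δg = -Λg`) every steady
  state obeys `‖∇v‖₂² ≤ Λ‖v‖₂²`, `∫‖Δv‖² ≤ Λ²‖v‖₂²` (CTV §2 (stbounds)): bounded steady branches
  under single-shell forcing are `H²`-bounded UNIFORMLY in `ν` (no vanishing-width layers).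

No new definitions.
-/

noncomputable section

open MeasureTheory Set Filter Topology UnitAddTorus
open scoped ENNReal NNReal InnerProductSpace

namespace Summit.AnomalousDissipation.AnomalousDissipation.Theorems.TwodBoundedEnergyZeroMomentum.Negative

open Literature.Analysis.FunctionSpaces Literature.Analysis.FunctionSpaces.Torus
open Literature.Analysis.FluidPDE Literature.Analysis.FluidPDE.Torus
open Literature.Barriers.AnomalousDissipation

variable {ν : ℝ} {g v : UnitAddTorus (Fin 2) → EuclideanSpace ℝ (Fin 2)} {p : UnitAddTorus (Fin 2) → ℝ}

/-- **A condensate costs palinstrophy above the forcing shell.** For a smooth steady state `v` of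
`NS_ν(g)` on `𝕋²`, `ν ≠ 0`, with a Stokes eigenforce `Δg = -Λg`, `Λ ≥ 4π²`:
`4π²(Λ - 4π²) ∑_{|k|² = 1} ‖v̂(k)‖² ≤ ∑_{k : λ_k > Λ} λ_k² ‖v̂(k)‖²` (`λ_k = 4π²|k|²`; the right
side is the palinstrophy `∫‖Δ(Q_Λ v)‖²` of the component strictly above the forcing shell). From the
straddle identity: the terms below the shell are `≤ 0` and include the first-shell ones, those above
are `≤ λ_k²‖v̂(k)‖²`. [cite: ConstantinTarfuleaVicol2013, §2 (h2bal)] -/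
theorem steady_firstShell_energy_le_supershell_palinstrophy (hν : ν ≠ 0)
    (hv : IsSteadyNSState ν g v p) {Λ : ℝ} (hΛ : ∀ x, laplacian g x = -Λ • g x)
    (hΛ1 : 4 * Real.pi ^ 2 ≤ Λ) :
    4 * Real.pi ^ 2 * (Λ - 4 * Real.pi ^ 2) *
        ∑ k ∈ shellOne, ‖mFourierCoeff (EuclideanSpace.complexify ∘ v) k‖ ^ 2 ≤
      ∑' k : Fin 2 → ℤ, (if Λ < 4 * Real.pi ^ 2 * freqNormSq k then
        (4 * Real.pi ^ 2 * freqNormSq k) ^ 2 * ‖mFourierCoeff (EuclideanSpace.complexify ∘ v) k‖ ^ 2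
        else 0) := by
  classical
  set c : (Fin 2 → ℤ) → ℝ := fun k => ‖mFourierCoeff (EuclideanSpace.complexify ∘ v) k‖ ^ 2 with hc
  set lam : (Fin 2 → ℤ) → ℝ := fun k => 4 * Real.pi ^ 2 * freqNormSq k with hlam
  set f : (Fin 2 → ℤ) → ℝ := fun k => lam k * (lam k - Λ) * c k with hf
  set A : Set (Fin 2 → ℤ) := {k | Λ < lam k} with hA
  have hΛ0 : 0 ≤ Λ := le_trans (by positivity) hΛ1
  have hlam0 : ∀ k, 0 ≤ lam k := fun k => by
    have := freqNormSq_nonneg k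
    simp only [hlam]
    positivity
  have hc0 : ∀ k, 0 ≤ c k := fun k => sq_nonneg _
  have hsum : HasSum f 0 := by
    have h := steady_hasSum_straddle hν hv hΛ
    exact h
  have hsf : Summable f := hsum.summable
  -- split `f` along `A`
  have hsA : Summable (A.indicator f) := hsf.indicator A
  have hsAc : Summable (Aᶜ.indicator f) := hsf.indicator Aᶜ
  have hsplit : (∑' k, A.indicator f k) + ∑' k, Aᶜ.indicator f k = 0 := by
    rw [← hsA.tsum_add hsAc]
    have : (fun k => A.indicator f k + Aᶜ.indicator f k) = f := by
      funext k
      exact congrFun (Set.indicator_self_add_compl A f) k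
    rw [this, hsum.tsum_eq]
  -- the part above the shell is dominated by the super-shell palinstrophy
  have hP : Summable fun k => lam k ^ 2 * c k :=
    (hasSum_eigenvalue_sq_mul_sq_norm_mFourierCoeff (steady_isSmooth hv)).summable
  have hPA : Summable (A.indicator fun k => lam k ^ 2 * c k) := hP.indicator A
  have hup : ∑' k, A.indicator f k ≤ ∑' k, A.indicator (fun k => lam k ^ 2 * c k) k := by
    refine Summable.tsum_le_tsum (fun k => ?_) hsA hPA
    by_cases hk : k ∈ A
    · rw [Set.indicator_of_mem hk, Set.indicator_of_mem hk]
      simp only [hf]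
      have h1 : lam k * (lam k - Λ) ≤ lam k ^ 2 := by nlinarith [hlam0 k, hΛ0]
      exact mul_le_mul_of_nonneg_right h1 (hc0 k)
    · rw [Set.indicator_of_notMem hk, Set.indicator_of_notMem hk]
  -- the part below (or on) the shell is at most its first-shell terms
  have hneg : ∀ k, Aᶜ.indicator f k ≤ 0 := by
    intro k
    by_cases hk : k ∈ Aᶜ
    · rw [Set.indicator_of_mem hk]
      have hk' : lam k ≤ Λ := by
        rw [Set.mem_compl_iff, hA, Set.mem_setOf_eq, not_lt] at hk
        exact hk
      have h1 : lam k * (lam k - Λ) ≤ 0 := by nlinarith [hlam0 k]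
      show lam k * (lam k - Λ) * c k ≤ 0
      nlinarith [hc0 k]
    · rw [Set.indicator_of_notMem hk]
  have hshell : ∀ k ∈ shellOne, Aᶜ.indicator f k = -(4 * Real.pi ^ 2 * (Λ - 4 * Real.pi ^ 2)) * c k := by
    intro k hk
    have hk1 : freqNormSq k = 1 := mem_shellOne.1 hk
    have hlk : lam k = 4 * Real.pi ^ 2 := by simp only [hlam, hk1, mul_one]
    have hkA : k ∈ Aᶜ := by
      rw [Set.mem_compl_iff, hA, Set.mem_setOf_eq, not_lt, hlk]
      exact hΛ1
    rw [Set.indicator_of_mem hkA]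
    show lam k * (lam k - Λ) * c k = -(4 * Real.pi ^ 2 * (Λ - 4 * Real.pi ^ 2)) * c k
    rw [hlk]
    ring
  have hlow : ∑' k, Aᶜ.indicator f k ≤ ∑ k ∈ shellOne, Aᶜ.indicator f k := by
    have h := sum_le_hasSum shellOne (fun k _ => neg_nonneg.2 (hneg k)) hsAc.hasSum.neg
    rw [Finset.sum_neg_distrib] at h
    linarith
  -- assemble
  rw [Finset.sum_congr rfl hshell, ← Finset.mul_sum] at hlow
  have hrhs : (∑' k, A.indicator (fun k => lam k ^ 2 * c k) k) =
      ∑' k : Fin 2 → ℤ, (if Λ < 4 * Real.pi ^ 2 * freqNormSq k then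
        (4 * Real.pi ^ 2 * freqNormSq k) ^ 2 * ‖mFourierCoeff (EuclideanSpace.complexify ∘ v) k‖ ^ 2
        else 0) := by
    refine tsum_congr fun k => ?_
    simp only [Set.indicator_apply, hA, Set.mem_setOf_eq, hlam, hc]
  rw [← hrhs]
  linarith [hsplit, hup, hlow]

/-! ### Interpolation and the steady dissipation bound -/

/-- **`(‖∇v‖₂²)² ≤ ‖v‖₂² ∫‖Δv‖²` for smooth fields** (Green's identity `‖∇v‖₂² = -∫⟪v, Δv⟫` and
Cauchy–Schwarz; the spatial half of Alexakis–Doering's `⟨ω²⟩² ≤ ⟨|u|²⟩⟨|∇ω|²⟩`). [cite: AlexakisDoering2006PLA, §2] -/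
theorem gradNormSq_sq_le_of_isSmooth {d : Type*} [Fintype d] [DecidableEq d]
    {w : UnitAddTorus d → EuclideanSpace ℝ d} (hw : IsSmooth w) :
    gradNormSq w ^ 2 ≤ (∫ x, ‖w x‖ ^ 2) * ∫ x, ‖laplacian w x‖ ^ 2 := by
  have hgreen : gradNormSq w = -∫ x, ⟪w x, laplacian w x⟫_ℝ := by
    have hint : ∀ i, Integrable (fun x => ‖partialDeriv i w x‖ ^ 2) volume := fun i =>
      (((hw.partialDeriv i).continuous.norm).pow 2).integrable_unitAddTorus
    rw [← Torus.sum_integral_inner_partialDeriv_eq_neg_integral_inner_laplacian hw hw, gradNormSq,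
      integral_finsetSum _ fun i _ => hint i]
    refine Finset.sum_congr rfl fun i _ => integral_congr_ae (ae_of_all _ fun x => ?_)
    exact (real_inner_self_eq_norm_sq _).symm
  have hcs : |∫ x, ⟪w x, laplacian w x⟫_ℝ| ≤
      Real.sqrt (∫ x, ‖w x‖ ^ 2) * Real.sqrt (∫ x, ‖laplacian w x‖ ^ 2) :=
    abs_integral_inner_le_sqrt_mul_sqrt (hw.memLp 2) (hw.laplacian.memLp 2)
  have h0 : 0 ≤ ∫ x, ‖w x‖ ^ 2 := integral_nonneg fun _ => sq_nonneg _
  have h1 : 0 ≤ ∫ x, ‖laplacian w x‖ ^ 2 := integral_nonneg fun _ => sq_nonneg _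
  calc gradNormSq w ^ 2 = |∫ x, ⟪w x, laplacian w x⟫_ℝ| ^ 2 := by rw [hgreen, ← sq_abs, abs_neg]
    _ ≤ (Real.sqrt (∫ x, ‖w x‖ ^ 2) * Real.sqrt (∫ x, ‖laplacian w x‖ ^ 2)) ^ 2 :=
        pow_le_pow_left₀ (abs_nonneg _) hcs 2
    _ = (∫ x, ‖w x‖ ^ 2) * ∫ x, ‖laplacian w x‖ ^ 2 := by
        rw [mul_pow, Real.sq_sqrt h0, Real.sq_sqrt h1]

/-- **The steady dissipation/injection bound** (Alexakis–Doering for steady states;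
Constantin–Tarfulea–Vicol 2013 §2): for a smooth steady state of `NS_ν(g)` on `𝕋²`, `ν ≥ 0`,
`(∫⟪g, v⟫)² ≤ ν ‖v‖₂² (‖v‖₂ ‖Δg‖₂)` — the work of the force (`= ν‖∇v‖₂²`, the dissipation) is at
most `ν^{1/2}‖v‖₂^{3/2}‖Δg‖₂^{1/2}`. Along a bounded steady branch (`‖v_j‖₂² ≤ E`, `ν_j → 0`) the
injection therefore vanishes like `ν_j^{1/2}`: no anomalous dissipation on bounded steady branches, and
every `L²`-limit `V` of the branch does no work, `∫⟪g, V⟫ = 0`. [cite: ConstantinTarfuleaVicol2013, §2] -/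
theorem steady_work_sq_le (hν : 0 ≤ ν) (hv : IsSteadyNSState ν g v p) :
    (∫ x, ⟪g x, v x⟫_ℝ) ^ 2 ≤
      ν * (∫ x, ‖v x‖ ^ 2) * (Real.sqrt (∫ x, ‖v x‖ ^ 2) * Real.sqrt (∫ x, ‖laplacian g x‖ ^ 2)) := by
  have hvs := steady_isSmooth hv
  have hgs := steady_isSmooth_force hv
  have hE := steady_energy_identity hv
  have hZ := steady_enstrophy_identity hv
  have hint := gradNormSq_sq_le_of_isSmooth hvs
  have h0 : 0 ≤ ∫ x, ‖v x‖ ^ 2 := integral_nonneg fun _ => sq_nonneg _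
  have hG0 : 0 ≤ gradNormSq v := gradNormSq_nonneg v
  -- `ν ∫‖Δv‖² ≤ ‖v‖₂ ‖Δg‖₂`
  have hcs : |∫ x, ⟪v x, laplacian g x⟫_ℝ| ≤
      Real.sqrt (∫ x, ‖v x‖ ^ 2) * Real.sqrt (∫ x, ‖laplacian g x‖ ^ 2) :=
    abs_integral_inner_le_sqrt_mul_sqrt (hvs.memLp 2) (hgs.laplacian.memLp 2)
  have hνL : ν * ∫ x, ‖laplacian v x‖ ^ 2 ≤
      Real.sqrt (∫ x, ‖v x‖ ^ 2) * Real.sqrt (∫ x, ‖laplacian g x‖ ^ 2) := by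
    rw [hZ]
    exact (neg_le_abs _).trans hcs
  -- `(∫⟪g,v⟫)² = ν² G² ≤ ν² ‖v‖² ∫‖Δv‖² = ν ‖v‖² (ν∫‖Δv‖²)`
  rw [← hE]
  calc (ν * gradNormSq v) ^ 2 = ν ^ 2 * gradNormSq v ^ 2 := by ring
    _ ≤ ν ^ 2 * ((∫ x, ‖v x‖ ^ 2) * ∫ x, ‖laplacian v x‖ ^ 2) :=
        mul_le_mul_of_nonneg_left hint (sq_nonneg ν)
    _ = ν * (∫ x, ‖v x‖ ^ 2) * (ν * ∫ x, ‖laplacian v x‖ ^ 2) := by ring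
    _ ≤ ν * (∫ x, ‖v x‖ ^ 2) * (Real.sqrt (∫ x, ‖v x‖ ^ 2) * Real.sqrt (∫ x, ‖laplacian g x‖ ^ 2)) :=
        mul_le_mul_of_nonneg_left hνL (mul_nonneg hν h0)

/-- **Steady states under Kolmogorov forcing are `H²`-bounded by their energy, uniformly in `ν`**
(Constantin–Tarfulea–Vicol 2013 §2, (stbounds)): for a smooth steady state of `NS_ν(g)` on `𝕋²`,
`ν ≠ 0`, with a Stokes eigenforce `Δg = -Λg`, `Λ ≥ 0`:
`‖∇v‖₂² ≤ Λ ‖v‖₂²` and `∫‖Δv‖² ≤ Λ² ‖v‖₂²` (from `∫‖Δv‖² = Λ‖∇v‖₂²` and the interpolation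
`(‖∇v‖₂²)² ≤ ‖v‖₂²∫‖Δv‖²`). CONSEQUENCE for the crux ideas with single-shell forcing: a bounded
steady branch (`‖v_j‖₂² ≤ E`) is bounded in `H²` UNIFORMLY IN `ν_j` — no internal or boundary layers
of vanishing width, no palinstrophy growth; every limit is a strong `H¹` limit and a steady forced
Euler state (CTV §2 (steu)). [cite: ConstantinTarfuleaVicol2013, §2 (stbounds)] -/
theorem steady_sobolev_bounds_of_stokesEigenforce (hν : ν ≠ 0) (hv : IsSteadyNSState ν g v p)
    {Λ : ℝ} (hΛ : ∀ x, laplacian g x = -Λ • g x) (hΛ0 : 0 ≤ Λ) :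
    gradNormSq v ≤ Λ * ∫ x, ‖v x‖ ^ 2 ∧ ∫ x, ‖laplacian v x‖ ^ 2 ≤ Λ ^ 2 * ∫ x, ‖v x‖ ^ 2 := by
  have hvs := steady_isSmooth hv
  have hP := steady_laplacian_sq_eq_of_stokesEigenforce hν hv hΛ
  have hint := gradNormSq_sq_le_of_isSmooth hvs
  have hG0 : 0 ≤ gradNormSq v := gradNormSq_nonneg v
  have hE0 : 0 ≤ ∫ x, ‖v x‖ ^ 2 := integral_nonneg fun _ => sq_nonneg _
  rw [hP] at hint
  -- `G² ≤ E Λ G ⇒ G ≤ Λ E`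
  have hG : gradNormSq v ≤ Λ * ∫ x, ‖v x‖ ^ 2 := by
    by_contra hlt
    push Not at hlt
    have hpos : 0 < gradNormSq v := lt_of_le_of_lt (by positivity) hlt
    have h1 : (Λ * ∫ x, ‖v x‖ ^ 2) * gradNormSq v < gradNormSq v * gradNormSq v :=
      mul_lt_mul_of_pos_right hlt hpos
    nlinarith
  refine ⟨hG, ?_⟩
  rw [hP]
  calc Λ * gradNormSq v ≤ Λ * (Λ * ∫ x, ‖v x‖ ^ 2) := mul_le_mul_of_nonneg_left hG hΛ0
    _ = Λ ^ 2 * ∫ x, ‖v x‖ ^ 2 := by ring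

end Summit.AnomalousDissipation.AnomalousDissipation.Theorems.TwodBoundedEnergyZeroMomentum.Negative

end
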